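import Summits.Parity.BatemanHorn.Theorems.SoloInformedTrapezoidBlock

/-!
# The trapezoid method: low-frequency bounds for the Abel coefficients, and Abel summation with constant bounds

Informed soloist `solo-Parity-informed` (session 144), conjunct `BatemanHorn`, the `d ≥ 3` rung BELOW the parity
wall.  `SoloInformedTrapezoidBlock` bounds the Abel coefficients `c_e(h) = K_e(h)/e` of the trapezoid form and their
variation in the modulus by `D/(2|h|)` and `W₁/(e|h|) + W₂/e³` — bounds that win a factor `|h|` from the
oscillation of the phase `m ↦ e(−hm/e)` and are the right ones for `|h| ≫ E/X₀`.  For LOW frequencies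
`|h| ≤ H₀ ≍ E/X₀` the phase does not oscillate over the support `m ≤ X₀ + D` of the weights and the TRIVIAL bounds
are better:
* `|K_e(h)| ≤ ∑_m |Φ_e(m)| ≤ D(N+1)` (`N = X₀ + D + 2`), so `|c_e(h)| ≤ D(N+1)/e` (`norm_trapCoef_le_low`);
* `|c_{e+1}(h) − c_e(h)| ≤ D(N+1)·(1 + 1/(2Δ) + 2πN|h|/e)/e²` (`norm_trapCoef_succ_sub_le_low`): the weight
  variation `∑_m |Ψ_e(m)| ≤ D(N+1)/(2Δe)` (the ramp `a_e` is `1/(2Δ)`-Lipschitz in `log e`), the phase variation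
  `∑_m |Φ_e(m)|·|ξ^m − 1| ≤ D·N(N+1)·2π|h|/(e(e+1))` at FIRST order, and `|K_e(h)|/(e(e+1))`.
We also record the Abel summation in the modulus against an `ℓ¹`-in-`h` hypothesis with CONSTANT (frequency-
independent) coefficient bounds (`sum_norm_sum_Ioc_mul_le_of_const`) and the version of
`sum_norm_sum_Ioc_mul_le_of_factorised` over an arbitrary finite set of frequencies
(`sum_norm_sum_Ioc_mul_le_of_factorised_on`); `SoloInformedTrapezoidBlockProfile` combines them into the block
estimate with the frequency range split at `H₀`.
-/

namespace Summit.Parity.BatemanHorn.Theorems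

open Finset Polynomial

/-! ### Mass bounds for the weights and the kernel -/

/-- `|Ψ_e(m)| ≤ D·σ_e`, `σ_e = (log(e+1) − log e)/(2Δ)` (`e ≥ 1`, no integer roots). [this work] -/
theorem norm_trapPsi_le (g : ℤ[X]) {Δ : ℝ} (hΔ : 0 < Δ) (X₀ D : ℕ) {e : ℕ} (he : 1 ≤ e)
    (hz : ∀ k : ℕ, g.eval (k : ℤ) ≠ 0) (m : ℕ) :
    ‖trapPsi g Δ X₀ D e m‖ ≤ (D : ℝ) * ((Real.log ((e : ℝ) + 1) - Real.log e) / (2 * Δ)) := by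
  rw [trapPsi, norm_mul, norm_trapW]
  have h1 : (trapCount X₀ D m : ℝ) ≤ D := by exact_mod_cast trapCount_le X₀ D m
  have h2 : ‖locD g Δ e m‖ ≤ (Real.log ((e : ℝ) + 1) - Real.log e) / (2 * Δ) := by
    simp only [locD, Complex.norm_real, Real.norm_eq_abs]
    exact abs_locWeight_succ_e_sub_le g hΔ he (hz m)
  exact mul_le_mul h1 h2 (norm_nonneg _) (Nat.cast_nonneg _)

/-- `∑_{m ≤ N} |Ψ_e(m)| ≤ D(N+1)/(2Δe)` (`N = X₀ + D + 2`, `e ≥ 1`). [this work] -/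
theorem sum_norm_trapPsi_le (g : ℤ[X]) {Δ : ℝ} (hΔ : 0 < Δ) (X₀ D : ℕ) {e : ℕ} (he : 1 ≤ e)
    (hz : ∀ k : ℕ, g.eval (k : ℤ) ≠ 0) :
    ∑ m ∈ range (X₀ + D + 3), ‖trapPsi g Δ X₀ D e m‖ ≤ (D : ℝ) * ((X₀ + D + 3 : ℕ) : ℝ) / (2 * Δ * e) := by
  have hσ := shiftWidth_le hΔ he
  calc ∑ m ∈ range (X₀ + D + 3), ‖trapPsi g Δ X₀ D e m‖
      ≤ ∑ _m ∈ range (X₀ + D + 3), (D : ℝ) * (1 / (2 * Δ * e)) :=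
        sum_le_sum fun m _ => (norm_trapPsi_le g hΔ X₀ D he hz m).trans
          (mul_le_mul_of_nonneg_left hσ (Nat.cast_nonneg _))
    _ = (D : ℝ) * ((X₀ + D + 3 : ℕ) : ℝ) / (2 * Δ * e) := by
        rw [sum_const, card_range, nsmul_eq_mul]
        ring

/-- **First-order phase variation**: `|K_N(Φ_e·(ξ^· − 1); w)| ≤ D·N·(N+1)·|ξ − 1|` for `|w| ≤ 1`, `|ξ| = 1`
(`N = X₀ + D + 2`). [this work] -/
theorem norm_kernelSum_trapPhi_phase_le_low (g : ℤ[X]) (Δ : ℝ) (X₀ D e : ℕ) {ξ w : ℂ} (hξ : ‖ξ‖ = 1)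
    (hw : ‖w‖ ≤ 1) :
    ‖kernelSum (X₀ + D + 2) (fun m => trapPhi g Δ X₀ D e m * (ξ ^ m - 1)) w‖
      ≤ (D : ℝ) * ((X₀ + D + 2 : ℕ) : ℝ) * ((X₀ + D + 3 : ℕ) : ℝ) * ‖ξ - 1‖ := by
  refine (norm_kernelSum_le _ _ hw).trans ?_
  have hpt : ∀ m ∈ range (X₀ + D + 2 + 1),
      ‖trapPhi g Δ X₀ D e m * (ξ ^ m - 1)‖ ≤ (D : ℝ) * (((X₀ + D + 2 : ℕ) : ℝ) * ‖ξ - 1‖) := by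
    intro m hm
    have hmN : (m : ℝ) ≤ ((X₀ + D + 2 : ℕ) : ℝ) := by exact_mod_cast Nat.lt_succ_iff.mp (mem_range.mp hm)
    rw [norm_mul]
    exact mul_le_mul (norm_trapPhi_le g Δ X₀ D e m)
      ((norm_pow_sub_one_le hξ m).trans (mul_le_mul_of_nonneg_right hmN (norm_nonneg _)))
      (norm_nonneg _) (Nat.cast_nonneg _)
  refine (sum_le_sum hpt).trans (le_of_eq ?_)
  rw [sum_const, card_range, nsmul_eq_mul]
  push_cast
  ring

/-- **`|K_e(h)| ≤ D(N+1)`** (`N = X₀ + D + 2`): the trivial bound. [this work] -/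
theorem norm_trapKs_le (g : ℤ[X]) (Δ : ℝ) (X₀ D e : ℕ) (h : ℤ) :
    ‖trapKs g Δ X₀ D e h‖ ≤ (D : ℝ) * ((X₀ + D + 3 : ℕ) : ℝ) := by
  unfold trapKs
  exact (norm_kernelSum_le _ _ (norm_eAdd e (-h)).le).trans (sum_norm_trapPhi_le g Δ X₀ D e)

/-- **`|c_e(h)| ≤ D(N+1)/e`** (`e ≥ 1`): the low-frequency bound for the Abel coefficients. [this work] -/
theorem norm_trapCoef_le_low (g : ℤ[X]) (Δ : ℝ) (X₀ D : ℕ) {e : ℕ} (he : 1 ≤ e) (h : ℤ) :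
    ‖trapCoef g Δ X₀ D e h‖ ≤ (D : ℝ) * ((X₀ + D + 3 : ℕ) : ℝ) / e := by
  have he' : (0 : ℝ) < e := by exact_mod_cast he
  unfold trapCoef
  rw [norm_div, Complex.norm_natCast]
  exact div_le_div_of_nonneg_right (norm_trapKs_le g Δ X₀ D e h) he'.le

/-- Real arithmetic of the low-frequency coefficient variation. [this work] -/
theorem coefLow_variation_aux {a b Δ e : ℝ} (ha : 0 ≤ a) (hb : 0 ≤ b) (hΔ : 0 < Δ) (he : 1 ≤ e) :
    (a / (2 * Δ * e) + a * b / (e * (e + 1))) / (e + 1) + a / (e * (e + 1))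
      ≤ a * (1 + 1 / (2 * Δ) + b / e) / e ^ 2 := by
  have he0 : 0 < e := by linarith
  have t1 : a / (2 * Δ * e) / (e + 1) ≤ a / (2 * Δ) / e ^ 2 := by
    rw [div_div, div_div, div_le_div_iff₀ (by positivity) (by positivity)]
    have : 2 * Δ * e ^ 2 ≤ 2 * Δ * e * (e + 1) := by nlinarith
    exact mul_le_mul_of_nonneg_left this ha
  have t2 : a * b / (e * (e + 1)) / (e + 1) ≤ a * (b / e) / e ^ 2 := by
    rw [div_div, mul_div_assoc', div_div, div_le_div_iff₀ (by positivity) (by positivity)]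
    have : e * e ^ 2 ≤ e * (e + 1) * (e + 1) := by nlinarith
    exact mul_le_mul_of_nonneg_left this (mul_nonneg ha hb)
  have t3 : a / (e * (e + 1)) ≤ a / e ^ 2 := by
    refine div_le_div_of_nonneg_left ha (by positivity) (by nlinarith)
  have eq : a * (1 + 1 / (2 * Δ) + b / e) / e ^ 2 = a / e ^ 2 + a / (2 * Δ) / e ^ 2 + a * (b / e) / e ^ 2 := by
    field_simp
  rw [add_div, eq]
  linarith

/-- **`|c_{e+1}(h) − c_e(h)| ≤ D(N+1)·(1 + 1/(2Δ) + 2πN|h|/e)/e²`** (`N = X₀ + D + 2`, `e ≥ 1`, no integer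
roots): the low-frequency bound for the variation of the Abel coefficients in the modulus — weight variation
`D(N+1)/(2Δe)`, phase variation `D·N(N+1)·2π|h|/(e(e+1))` at first order, and `|K_e(h)|/(e(e+1))`. [this work] -/
theorem norm_trapCoef_succ_sub_le_low (g : ℤ[X]) {Δ : ℝ} (hΔ : 0 < Δ) (X₀ D : ℕ) {e : ℕ} (he : 1 ≤ e)
    (hz : ∀ k : ℕ, g.eval (k : ℤ) ≠ 0) (h : ℤ) :
    ‖trapCoef g Δ X₀ D (e + 1) h - trapCoef g Δ X₀ D e h‖
      ≤ (D : ℝ) * ((X₀ + D + 3 : ℕ) : ℝ)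
          * (1 + 1 / (2 * Δ) + 2 * Real.pi * ((X₀ + D + 2 : ℕ) : ℝ) * |(h : ℝ)| / e) / (e : ℝ) ^ 2 := by
  have he0 : e ≠ 0 := by omega
  have he' : (1 : ℝ) ≤ e := by exact_mod_cast he
  have he'' : (0 : ℝ) < e := by linarith
  set N₁ : ℝ := ((X₀ + D + 3 : ℕ) : ℝ) with hN₁
  set N : ℝ := ((X₀ + D + 2 : ℕ) : ℝ) with hN
  have hN0 : 0 ≤ N := Nat.cast_nonneg _
  have hN₁0 : 0 ≤ N₁ := Nat.cast_nonneg _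
  -- the three kernel bounds
  have hΨ : ‖kernelSum (X₀ + D + 2) (trapPsi g Δ X₀ D e) (eAdd (e + 1) (-h))‖ ≤ (D : ℝ) * N₁ / (2 * Δ * e) :=
    (norm_kernelSum_le _ _ (norm_eAdd _ _).le).trans (sum_norm_trapPsi_le g hΔ X₀ D he hz)
  have hφ : ‖kernelSum (X₀ + D + 2) (fun m => trapPhi g Δ X₀ D e m * (eAdd (e * (e + 1)) h ^ m - 1))
        (eAdd e (-h))‖ ≤ (D : ℝ) * N₁ * (2 * Real.pi * N * |(h : ℝ)|) / ((e : ℝ) * ((e : ℝ) + 1)) := by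
    refine (norm_kernelSum_trapPhi_phase_le_low g Δ X₀ D e (norm_eAdd _ _) (norm_eAdd _ _).le).trans ?_
    have hξ := norm_eAdd_mul_succ_sub_one_le he0 h
    calc (D : ℝ) * N * N₁ * ‖eAdd (e * (e + 1)) h - 1‖
        ≤ (D : ℝ) * N * N₁ * (2 * Real.pi * |(h : ℝ)| / ((e : ℝ) * ((e : ℝ) + 1))) :=
          mul_le_mul_of_nonneg_left hξ (by positivity)
      _ = (D : ℝ) * N₁ * (2 * Real.pi * N * |(h : ℝ)|) / ((e : ℝ) * ((e : ℝ) + 1)) := by ring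
  have hK : ‖trapKs g Δ X₀ D e h‖ ≤ (D : ℝ) * N₁ := norm_trapKs_le g Δ X₀ D e h
  -- assemble
  have hcast1 : ((e : ℂ) + 1) = ((e + 1 : ℕ) : ℂ) := by push_cast; ring
  rw [trapCoef_succ_sub_eq g Δ X₀ D he0 h]
  refine (norm_sub_le _ _).trans ?_
  rw [norm_div, norm_div, norm_mul, hcast1, Complex.norm_natCast, Complex.norm_natCast]
  push_cast
  refine (add_le_add (div_le_div_of_nonneg_right ((norm_add_le _ _).trans (add_le_add hΨ hφ)) (by positivity))
    (div_le_div_of_nonneg_right hK (by positivity))).trans ?_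
  have key := coefLow_variation_aux (a := (D : ℝ) * N₁) (b := 2 * Real.pi * N * |(h : ℝ)|) (by positivity)
    (by positivity) hΔ he'
  refine (le_of_eq ?_).trans (key.trans (le_of_eq ?_))
  · rw [mul_div_assoc]
  · ring

/-! ### Abel summation in the modulus with constant coefficient bounds -/

/-- `∑_{E<e<E'} 1/e² ≤ 1/E` for `E' ≤ 2E`, `E ≥ 1`. [folklore] -/
theorem sum_Ioo_one_div_sq_le {E E' : ℕ} (hE : 1 ≤ E) (hE' : E' ≤ 2 * E) :
    ∑ e ∈ Ioo E E', 1 / (e : ℝ) ^ 2 ≤ 1 / (E : ℝ) := by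
  have hE0 : (0 : ℝ) < E := by exact_mod_cast hE
  have hpt : ∀ e ∈ Ioo E E', 1 / (e : ℝ) ^ 2 ≤ 1 / (E : ℝ) * (1 / (e : ℝ)) := by
    intro e he
    rw [mem_Ioo] at he
    have he0 : (0 : ℝ) < e := by exact_mod_cast (show 0 < e by omega)
    have hEe : (E : ℝ) ≤ e := by exact_mod_cast he.1.le
    rw [sq, one_div_mul_one_div, one_div_le_one_div (by positivity) (by positivity)]
    exact mul_le_mul_of_nonneg_right hEe he0.le
  refine (sum_le_sum hpt).trans ?_
  rw [← mul_sum]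
  calc 1 / (E : ℝ) * ∑ e ∈ Ioo E E', 1 / (e : ℝ) ≤ 1 / (E : ℝ) * 1 :=
        mul_le_mul_of_nonneg_left (sum_Ioo_one_div_le_one hE') (by positivity)
    _ = 1 / (E : ℝ) := mul_one _

/-- **Abel summation in the modulus against an `ℓ¹`-in-`h` hypothesis, constant coefficient bounds.**  For weights
`c_e(h)` with `|c_{E'}(h)| ≤ B₀` and `|c_{e+1}(h) − c_e(h)| ≤ W/e²` (`E < e < E'`, `h ∈ S`), and signals whose partial
sums `T_t(h) = ∑_{E<i≤t} s_i(h)` satisfy `∑_{h∈S} |T_t(h)| ≤ L₀` for every `E ≤ t ≤ E'` (`1 ≤ E ≤ E' ≤ 2E`):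
`∑_{h∈S} |∑_{E<e≤E'} c_e(h)s_e(h)| ≤ (B₀ + W/E)·L₀`. [this work] -/
theorem sum_norm_sum_Ioc_mul_le_of_const (c s : ℕ → ℕ → ℂ) (S : Finset ℕ) {E E' : ℕ} (hE : 1 ≤ E)
    (hEE' : E ≤ E') (hE' : E' ≤ 2 * E) {B₀ W L₀ : ℝ} (hB₀0 : 0 ≤ B₀) (hW0 : 0 ≤ W) (hL₀0 : 0 ≤ L₀)
    (hB₀ : ∀ h ∈ S, ‖c E' h‖ ≤ B₀)
    (hW : ∀ e ∈ Ioo E E', ∀ h ∈ S, ‖c (e + 1) h - c e h‖ ≤ W / (e : ℝ) ^ 2)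
    (hT : ∀ t ∈ Icc E E', ∑ h ∈ S, ‖∑ i ∈ Ioc E t, s i h‖ ≤ L₀) :
    ∑ h ∈ S, ‖∑ e ∈ Ioc E E', c e h * s e h‖ ≤ (B₀ + W / E) * L₀ := by
  have step1 : ∑ h ∈ S, ‖∑ e ∈ Ioc E E', c e h * s e h‖
      ≤ ∑ h ∈ S, (B₀ * ‖∑ e ∈ Ioc E E', s e h‖
          + ∑ e ∈ Ioo E E', W / (e : ℝ) ^ 2 * ‖∑ i ∈ Ioc E e, s i h‖) := by
    refine sum_le_sum fun h hh => ?_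
    refine (norm_sum_Ioc_mul_le_abel_termwise (fun e => c e h) (fun e => s e h) hEE').trans ?_
    exact add_le_add (mul_le_mul_of_nonneg_right (hB₀ h hh) (norm_nonneg _))
      (sum_le_sum fun e he => mul_le_mul_of_nonneg_right (hW e he h hh) (norm_nonneg _))
  refine step1.trans ?_
  rw [sum_add_distrib, sum_comm]
  have hbd : ∑ h ∈ S, B₀ * ‖∑ e ∈ Ioc E E', s e h‖ ≤ B₀ * L₀ := by
    rw [← mul_sum]
    exact mul_le_mul_of_nonneg_left (hT E' (mem_Icc.mpr ⟨hEE', le_rfl⟩)) hB₀0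
  have hvar : ∑ e ∈ Ioo E E', ∑ h ∈ S, W / (e : ℝ) ^ 2 * ‖∑ i ∈ Ioc E e, s i h‖ ≤ W / E * L₀ := by
    have hpt : ∀ e ∈ Ioo E E', ∑ h ∈ S, W / (e : ℝ) ^ 2 * ‖∑ i ∈ Ioc E e, s i h‖ ≤ W * L₀ * (1 / (e : ℝ) ^ 2) := by
      intro e he
      have he' : e ∈ Icc E E' := by rw [mem_Ioo] at he; exact mem_Icc.mpr ⟨he.1.le, he.2.le⟩
      rw [← mul_sum]
      calc W / (e : ℝ) ^ 2 * ∑ h ∈ S, ‖∑ i ∈ Ioc E e, s i h‖ ≤ W / (e : ℝ) ^ 2 * L₀ :=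
            mul_le_mul_of_nonneg_left (hT e he') (by positivity)
        _ = W * L₀ * (1 / (e : ℝ) ^ 2) := by ring
    refine (sum_le_sum hpt).trans ?_
    rw [← mul_sum]
    calc W * L₀ * ∑ e ∈ Ioo E E', 1 / (e : ℝ) ^ 2 ≤ W * L₀ * (1 / E) :=
          mul_le_mul_of_nonneg_left (sum_Ioo_one_div_sq_le hE hE') (mul_nonneg hW0 hL₀0)
      _ = W / E * L₀ := by ring
  rw [add_mul]
  exact add_le_add hbd hvar

/-- **Abel summation in the modulus against an `ℓ¹`-in-`h` hypothesis, factorised variation, on a finite set of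
frequencies `S`** (the version of `sum_norm_sum_Ioc_mul_le_of_factorised` with `S` in place of `1 ≤ h ≤ H`):
`∑_{h∈S} |∑_{E<e≤E'} c_e(h)s_e(h)| ≤ B₀L₁ + W₁L₁ + W₂L₀/E²`. [this work] -/
theorem sum_norm_sum_Ioc_mul_le_of_factorised_on (c s : ℕ → ℕ → ℂ) (S : Finset ℕ) {E E' : ℕ} (hE : 1 ≤ E)
    (hEE' : E ≤ E') (hE' : E' ≤ 2 * E) {B₀ W₁ W₂ L₀ L₁ : ℝ} (hB₀0 : 0 ≤ B₀) (hW₁ : 0 ≤ W₁) (hW₂ : 0 ≤ W₂)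
    (hL₀ : 0 ≤ L₀) (hL₁ : 0 ≤ L₁) (hB₀ : ∀ h ∈ S, ‖c E' h‖ ≤ B₀ / h)
    (hB : ∀ e ∈ Ioo E E', ∀ h ∈ S, ‖c (e + 1) h - c e h‖ ≤ W₁ / ((e : ℝ) * h) + W₂ / (e : ℝ) ^ 3)
    (hT₁ : ∀ t ∈ Icc E E', ∑ h ∈ S, ‖∑ i ∈ Ioc E t, s i h‖ / h ≤ L₁)
    (hT₀ : ∀ t ∈ Icc E E', ∑ h ∈ S, ‖∑ i ∈ Ioc E t, s i h‖ ≤ L₀) :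
    ∑ h ∈ S, ‖∑ e ∈ Ioc E E', c e h * s e h‖ ≤ B₀ * L₁ + W₁ * L₁ + W₂ * L₀ / (E : ℝ) ^ 2 := by
  have hE0 : (0 : ℝ) < E := by exact_mod_cast hE
  have step1 : ∑ h ∈ S, ‖∑ e ∈ Ioc E E', c e h * s e h‖
      ≤ ∑ h ∈ S, ((B₀ / h) * ‖∑ e ∈ Ioc E E', s e h‖
          + ∑ e ∈ Ioo E E', (W₁ / ((e : ℝ) * h) + W₂ / (e : ℝ) ^ 3) * ‖∑ i ∈ Ioc E e, s i h‖) := by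
    refine sum_le_sum fun h hh => ?_
    refine (norm_sum_Ioc_mul_le_abel_termwise (fun e => c e h) (fun e => s e h) hEE').trans ?_
    refine add_le_add (mul_le_mul_of_nonneg_right (hB₀ h hh) (norm_nonneg _)) ?_
    exact sum_le_sum fun e he => mul_le_mul_of_nonneg_right (hB e he h hh) (norm_nonneg _)
  refine step1.trans ?_
  rw [sum_add_distrib, sum_comm]
  have hbd : ∑ h ∈ S, B₀ / h * ‖∑ e ∈ Ioc E E', s e h‖ ≤ B₀ * L₁ := by
    calc ∑ h ∈ S, B₀ / h * ‖∑ e ∈ Ioc E E', s e h‖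
        = B₀ * ∑ h ∈ S, ‖∑ e ∈ Ioc E E', s e h‖ / h := by
          rw [mul_sum]; exact sum_congr rfl fun h _ => by ring
      _ ≤ B₀ * L₁ := mul_le_mul_of_nonneg_left (hT₁ E' (mem_Icc.mpr ⟨hEE', le_rfl⟩)) hB₀0
  have hvar : ∑ e ∈ Ioo E E', ∑ h ∈ S, (W₁ / ((e : ℝ) * h) + W₂ / (e : ℝ) ^ 3) * ‖∑ i ∈ Ioc E e, s i h‖
      ≤ W₁ * L₁ + W₂ * L₀ / (E : ℝ) ^ 2 := by
    have hpt : ∀ e ∈ Ioo E E',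
        ∑ h ∈ S, (W₁ / ((e : ℝ) * h) + W₂ / (e : ℝ) ^ 3) * ‖∑ i ∈ Ioc E e, s i h‖
          ≤ W₁ * (1 / (e : ℝ)) * L₁ + W₂ * (1 / (e : ℝ) ^ 3) * L₀ := by
      intro e he
      have he' : e ∈ Icc E E' := by rw [mem_Ioo] at he; exact mem_Icc.mpr ⟨he.1.le, he.2.le⟩
      have hsplit : ∑ h ∈ S, (W₁ / ((e : ℝ) * h) + W₂ / (e : ℝ) ^ 3) * ‖∑ i ∈ Ioc E e, s i h‖
          = W₁ * (1 / (e : ℝ)) * ∑ h ∈ S, ‖∑ i ∈ Ioc E e, s i h‖ / h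
            + W₂ * (1 / (e : ℝ) ^ 3) * ∑ h ∈ S, ‖∑ i ∈ Ioc E e, s i h‖ := by
        rw [mul_sum, mul_sum, ← sum_add_distrib]
        exact sum_congr rfl fun h _ => by ring
      rw [hsplit]
      exact add_le_add (mul_le_mul_of_nonneg_left (hT₁ e he') (by positivity))
        (mul_le_mul_of_nonneg_left (hT₀ e he') (by positivity))
    refine (sum_le_sum hpt).trans ?_
    rw [sum_add_distrib]
    have e1 : ∑ e ∈ Ioo E E', W₁ * (1 / (e : ℝ)) * L₁ = W₁ * L₁ * ∑ e ∈ Ioo E E', 1 / (e : ℝ) := by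
      rw [mul_sum]; exact sum_congr rfl fun e _ => by ring
    have e2 : ∑ e ∈ Ioo E E', W₂ * (1 / (e : ℝ) ^ 3) * L₀ = W₂ * L₀ * ∑ e ∈ Ioo E E', 1 / (e : ℝ) ^ 3 := by
      rw [mul_sum]; exact sum_congr rfl fun e _ => by ring
    rw [e1, e2]
    have k1 := mul_le_mul_of_nonneg_left (sum_Ioo_one_div_le_one hE') (mul_nonneg hW₁ hL₁)
    have k2 := mul_le_mul_of_nonneg_left (sum_Ioo_one_div_cube_le hE') (mul_nonneg hW₂ hL₀)
    rw [mul_one] at k1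
    rw [mul_one_div] at k2
    linarith
  linarith

end Summit.Parity.BatemanHorn.Theorems
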